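import Summits.KontsevichZagierPeriods.KontsevichZagierPeriods.Theses.TorsionLogs

/-!
# F3 WITNESS for the rung `NeronIsogeny` (line `NeronIsogeny` on crux `TorsionSectorComplete`,
# stmt-KontsevichZagierPeriods-14212; forward generator G1 `next-rung`, gen 13, seed g1-KontsevichZagierPeriods-17981)

The rung is the isogeny-graded family `NeronIsogenyMember : Bool → Prop` — member `false` := the floor decl
`Theses.TorsionLogs.NeronTorsionPrimitiveChain` VERBATIM (the identity isogeny of `E`: the seed, CLOSED), member `true` :=
the tied Vélu 2-isogeny Néron sector statement `NeronVeluSector` (the Néron triangle transported along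
`E → E' = E/⟨(e₁,0)⟩`) — and `NeronIsogeny := ∀ b, NeronIsogenyMember b`.  The floor specialises the rung at the
parameter `b := false`: the seed theorem (route link `Theses.TorsionLogs.NeronTorsionPrimitiveChain_holds :=
Cruxes.NeronTorsionSector.Translation.stub_assembly`, item stmt-KontsevichZagierPeriods-17981) IS that member (`Iff.rfl`).
No `sorry`.  Self-contained: verbatim copies of the three `def`s of `Lines/NeronIsogeny.lean` in the namespace
`…NeronIsogeny.Special` (the skeleton module proves the same fact about the registered decl as `rung_false`).
[cite: KontsevichZagier2001, §1.2] [cite: Velu1971]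
-/

noncomputable section

-- `Summit.KontsevichZagierPeriods.KontsevichZagierPeriods.…` is the tree's mandated layout (single-conjunct summit).
set_option linter.dupNamespace false

namespace Summit.KontsevichZagierPeriods.KontsevichZagierPeriods.Cruxes.TorsionSectorComplete.NeronIsogeny.Special

open Literature.NumberTheory.Transcendental
open Summit.KontsevichZagierPeriods.KontsevichZagierPeriods.Theses.TorsionLogs (NeronTorsionPrimitiveChain
  NeronTorsionPrimitiveChain_holds)

/-- Verbatim copy of `Lines/NeronIsogeny.lean :: NeronVeluSector` (member `true`). **The TIED VÉLU (2-ISOGENY) NÉRON SECTOR STATEMENT.**  Data: the floor's curve hypotheses verbatim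
(`f = 4x³ − g₂x − g₃`, `g₂³ ≠ 27g₃²`, largest root `e₁ > 0`, `f > 0` beyond), the quarter abscissa `c` (`e₁ < c`,
`(c − e₁)² = 3e₁² − g₂/4`), a FREE real point abscissa `x_R > e₁`, its `T`-translate `x_S` (`(x_S − e₁)(x_R − e₁) = 3e₁² − g₂/4`),
the Vélu image `X = x_R + x_S − e₁` on the isogenous cubic `F`, and representations pinned as: `rI'` = the `E'`-triangle
`2c−e₁ < z₁ < z₀ < X` of `z₁/(√F√F)`; `rR`, `rS` = the `E`-triangles at `x_R`, `x_S`; `rP` = the floor's quadrant; `rV` = the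
square `(2c−e₁, X)²` of `e₁/(√F(z₀)√F(z₁))`; `rL = [1<t<α, dt/t]`.  The VALUE HYPOTHESIS `8I' − 8I_R − 8I_S − rP + 4rV = m·rL`
gives `8•[rI'] − 8•[rR] − 8•[rS] − [rP] + 4•[rV] − m•[rL] ∈ KZ.relations`.
[cite: KontsevichZagier2001, §1.2] [cite: Velu1971] [cite: Lang1983, Ch. 11 Thm 1.1] -/
def NeronVeluSector : Prop :=
  ∀ (g₂ g₃ e₁ c xR xS X α : ℝ) (m : ℤ) (f F : ℝ → ℝ),
    (∀ x, f x = 4 * x ^ 3 - g₂ * x - g₃) → g₂ ^ 3 - 27 * g₃ ^ 2 ≠ 0 → f e₁ = 0 → 0 < e₁ →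
    (∀ x, e₁ < x → 0 < f x) → e₁ < c → (c - e₁) ^ 2 = 3 * e₁ ^ 2 - g₂ / 4 →
    e₁ < xR → (xS - e₁) * (xR - e₁) = 3 * e₁ ^ 2 - g₂ / 4 → X = xR + xS - e₁ →
    (∀ x, F x = 4 * x ^ 3 - (60 * e₁ ^ 2 - 4 * g₂) * x - (g₃ + 84 * e₁ ^ 3 - 7 * e₁ * g₂)) → 1 < α →
    ∀ (rI' rR rS rP rV : KZ.IntegralRep 2) (rL : KZ.IntegralRep 1),
    rI'.domain = {z | 2 * c - e₁ < z 1 ∧ z 1 < z 0 ∧ z 0 < X} →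
    Set.EqOn rI'.integrand (fun z => z 1 / (Real.sqrt (F (z 1)) * Real.sqrt (F (z 0)))) rI'.domain →
    rR.domain = {z | e₁ < z 1 ∧ z 1 < z 0 ∧ z 0 < xR} →
    Set.EqOn rR.integrand (fun z => z 1 / (Real.sqrt (f (z 1)) * Real.sqrt (f (z 0)))) rR.domain →
    rS.domain = {z | e₁ < z 1 ∧ z 1 < z 0 ∧ z 0 < xS} →
    Set.EqOn rS.integrand (fun z => z 1 / (Real.sqrt (f (z 1)) * Real.sqrt (f (z 0)))) rS.domain →
    rP.domain = {z | e₁ < z 0 ∧ e₁ < z 1} →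
    Set.EqOn rP.integrand
      (fun z => (Real.sqrt (f (z 0)))⁻¹ * ((g₂ * z 1 + 2 * g₃) / (2 * (z 1) ^ 2 * Real.sqrt (f (z 1))))) rP.domain →
    rV.domain = {z | 2 * c - e₁ < z 0 ∧ z 0 < X ∧ 2 * c - e₁ < z 1 ∧ z 1 < X} →
    Set.EqOn rV.integrand (fun z => e₁ / (Real.sqrt (F (z 0)) * Real.sqrt (F (z 1)))) rV.domain →
    rL.domain = {t | 1 < t 0 ∧ t 0 < α} → Set.EqOn rL.integrand (fun t => (t 0)⁻¹) rL.domain →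
    8 * rI'.value - 8 * rR.value - 8 * rS.value - rP.value + 4 * rV.value = m * rL.value →
    (8 : ℤ) • KZ.of rI' - (8 : ℤ) • KZ.of rR - (8 : ℤ) • KZ.of rS - KZ.of rP + (4 : ℤ) • KZ.of rV - m • KZ.of rL ∈
      KZ.relations

/-- Verbatim copy of `Lines/NeronIsogeny.lean :: NeronIsogenyMember`. **The family, graded by the isogeny (`false` ↦ the identity of `E`, `true` ↦ Vélu's 2-isogeny `E → E/⟨T⟩`).**
Member `false` is the floor decl `Theses.TorsionLogs.NeronTorsionPrimitiveChain` VERBATIM (the seed, CLOSED); member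
`true` is `NeronVeluSector`.  Honest containment: see the module docstring of `Lines/NeronIsogeny.lean` (the fold `x_R = c` of member `true` is the
floor's `(N,a) = (4,1)` instance with empty `E'`-cells). -/
def NeronIsogenyMember : Bool → Prop
  | false => NeronTorsionPrimitiveChain
  | true => NeronVeluSector

/-- Verbatim copy of `Lines/NeronIsogeny.lean :: NeronIsogeny` (THE RUNG). **Both members.** `∀ b, NeronIsogenyMember b` — the proved floor and the new Vélu sector
statement. -/
def NeronIsogeny : Prop := ∀ two : Bool, NeronIsogenyMember two

/-- Member `false` is the floor decl on the nose. -/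
theorem false_iff : NeronIsogenyMember false ↔ NeronTorsionPrimitiveChain :=
  Iff.rfl

/-- **F3 witness (named):** the floor (seed `stub_assembly`, route link `NeronTorsionPrimitiveChain_holds`) is the
member `false` of the family (the identity isogeny). -/
theorem rung_false : NeronIsogenyMember false :=
  NeronTorsionPrimitiveChain_holds

/-- The rung is exactly `floor ∧ member true` (honest containment: the rung adds ONE statement to the floor). -/
theorem rung_iff : NeronIsogeny ↔ NeronTorsionPrimitiveChain ∧ NeronVeluSector := by
  constructor
  · exact fun h => ⟨h false, h true⟩
  · rintro ⟨h₀, h₁⟩ (_ | _)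
    · exact h₀
    · exact h₁

/-- Given the floor (a theorem), the rung is equivalent to its new member. -/
theorem rung_iff_true : NeronIsogeny ↔ NeronIsogenyMember true :=
  ⟨fun h => h true, fun h => rung_iff.mpr ⟨NeronTorsionPrimitiveChain_holds, h⟩⟩

end Summit.KontsevichZagierPeriods.KontsevichZagierPeriods.Cruxes.TorsionSectorComplete.NeronIsogeny.Special

end
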